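import Literature.AnabelianGeometry.EtaleTheta.BiKummerGaloisSurjLaws
import Literature.AnabelianGeometry.EtaleTheta.Discharge.Sec4NonVacuity
import HarnessLib

/-!
# [EtTh] Def. 4.1 (ii): the named Galois-surjection laws hold at the toy §4 setting (consistency witness)

Proof-only companion (theorems only, no definitions) of `BiKummerGaloisSurjLaws.lean` (abc-iut-L2-t3):
the predicates `BiKummerSetting.GaloisSurjNatural` ("natural … OUTER homomorphism `Π^tp_X ↠ Aut_D(A^bs)`",
naturality up to inner automorphisms) and `BiKummerSetting.IsOpenKerGaloisSurj` (open kernels) HOLD for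
abc-iut-w5-d063's inhabitant `Toy.biKummerSetting` of the §4 setting (`Discharge/Sec4NonVacuity.lean`:
one-object base, `galoisSurj := 1`).  Together with the model instances over the genuine temperoid
(`Discharge/Sec4GaloisSurjLawsModel.lean`) this records that the two named laws are jointly satisfiable with
the rest of the §4 interface stack (consistency ≠ faithfulness).  S. Mochizuki, *The étale theta function …*,
Publ. RIMS **45** (2009) [EtTh], Def. 4.1 (ii), PDF p.87 [cite: MochizukiEtTh2009, Def 4.1 (ii) p.87].
HONEST FRAMING: a consistency check; nothing of [EtTh] is asserted; nothing here bears on [IUTchIII] Cor. 3.12.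
-/

noncomputable section

namespace Literature.AnabelianGeometry.EtaleTheta

open CategoryTheory Opposite Literature.AlgebraicGeometry.Frobenioids

namespace Toy

/-- Automorphism groups in the one-object discrete base category are trivial. [folklore] -/
private theorem subsingleton_aut_punit (A : Discrete PUnit.{1}) : Subsingleton (Aut A) :=
  ⟨fun _ _ => Iso.ext (Subsingleton.elim _ _)⟩

/-- At the toy setting every Galois surjection `Π^tp_X → Aut_D(A)` is the trivial homomorphism (its target
is the trivial group). [cite: MochizukiEtTh2009, Def 4.1 (ii) p.87] -/
theorem biKummerSetting_galoisSurj_eq_one (A : Discrete PUnit.{1}) (hA : biKummerSetting.IsGaloisObj A) :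
    biKummerSetting.galoisSurj A hA = 1 :=
  MonoidHom.ext fun _ => (subsingleton_aut_punit A).elim _ _

/-- **`GaloisSurjNatural` holds at the toy setting** (both sides of the naturality square are `b`; `c := 1`).
[cite: MochizukiEtTh2009, Def 4.1 (ii) p.87] -/
theorem biKummerSetting_galoisSurjNatural : biKummerSetting.GaloisSurjNatural := by
  intro A B hA hB b
  refine ⟨1, fun g => ?_⟩
  rw [biKummerSetting_galoisSurj_eq_one B hB, biKummerSetting_galoisSurj_eq_one A hA, MonoidHom.one_apply,
    MonoidHom.one_apply]
  change 𝟙 B ≫ b = b ≫ 𝟙 A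
  rw [Category.id_comp, Category.comp_id]

/-- **`IsOpenKerGaloisSurj` holds at the toy setting** (the kernel of the trivial homomorphism is all of
`Π^tp_X`, an open set). [cite: MochizukiEtTh2009, Def 4.1 (ii) p.87] -/
theorem biKummerSetting_isOpenKerGaloisSurj : biKummerSetting.IsOpenKerGaloisSurj := by
  intro A hA
  rw [biKummerSetting_galoisSurj_eq_one A hA, MonoidHom.ker_one, Subgroup.coe_top]
  exact isOpen_univ

/-- Hence both laws are jointly satisfiable with an inhabited §4 setting.
[cite: MochizukiEtTh2009, Def 4.1 (ii) p.87] -/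
theorem nonempty_biKummerSetting_galoisSurjLaws :
    ∃ S : BiKummerSetting temperedGroup realifiedQ (Discrete PUnit.{1}) catVocab,
      S.GaloisSurjNatural ∧ S.IsOpenKerGaloisSurj :=
  ⟨biKummerSetting, biKummerSetting_galoisSurjNatural, biKummerSetting_isOpenKerGaloisSurj⟩

end Toy

end Literature.AnabelianGeometry.EtaleTheta

end
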